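/-
Copyright (c) 2026 the pub-hodgecm-mathlib formalisation cell (harness21).  Prover seat hodgecm-mathlib-K2E4-p10 (g10), Track B «K2-LIT»,
#184♮ = hLiu418 = `stmt-HodgeConjecture-24832`; socket #41, KIND W — (3d-ii) «K-UNIFORMITY», THE GENERIC FINITE-SPAN REDUCTION: uniform growth of a FAMILY of continued
twisted archimedean letters that are bounded linear combinations of finitely many basis letters (KW desk F0P2-p08 (g4) brick (3d), 2026-09-05T01:22:15Z; road R-α's analytic half).
THEOREMS ONLY (no `def`, no `instance`, no notation, no named-fact hypothesis, no `sorry`).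
-/
import Summits.HodgeConjecture.HodgeConjecture.Theorems.K2LiuEisensteinContinuationGlue   -- ★ `eqOn_of_eqOn_halfPlane` (identity theorem on a half-plane)
import Summits.HodgeConjecture.HodgeConjecture.Theorems.K2LiuHermTwoXiSeriesLattice       -- ★ `one_add_rpow_neg_le_two_mul` (JUNCTION's determinant-exponent merge)
import HarnessLib

/-!
# Crux `HLiu418`, socket #41, KIND W — (3d-ii) `K2LiuKindWArchGrowthKUniform`: UNIFORM GROWTH OVER A FAMILY SPANNED BY FINITELY MANY CONTINUED LETTERS

Cell `hodgecm-mathlib`, crux item hLiu418 = `stmt-HodgeConjecture-24832` (helper lane `--supports … --as helper`, count-neutral), route of record `HCCMUnconditional`;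
squad K2 ∕ K2Liu, road `K2_Liu`, socket #41, KIND W, (iii-arch) block letter `hBL`; KW desk F0P2-p08 (g4), (3c) assembler K2E3-p11 (g10), FILE 2b LH4-p08 (g11).
THE POINT (desk (B) 2026-09-05T01:22:15Z + this seat's census 01:24:20Z).  FILE 2b `K2LiuKindWArchWhittakerGrowth.exists_twistedWhittaker_continuation_growth_of_posDef`
bounds the continued twisted unipotent integral `Ew` of ONE section in the face `Cg·‖det R‖^{2−2re s}·e^{−cg·T₂}·(1+T₂)^N·(1+‖det h₂‖)^{−N′}` with constants behind an `∃`;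
the block letter `hBL` needs ONE set of constants for the whole family of right-`K`-translates `F(· u₀)`, `u₀` in the (compact) stabiliser.  Road R-α: the translates
lie in the finite-dimensional `K`-stable space of the `K`-finite section (`hfin` of ★ p863767), so `F(· u₀) = Σ_{i∈B} a_i(u₀)·G_i` on a fixed finite basis with
`sup_{u₀} Σ_i |a_i(u₀)| ≤ Ma`; the twisted integral is linear in the section, so on the convergence half-plane `Ew_{u₀} = Σ_i a_i(u₀)·Ew_{G_i}`, and the identity theorem
carries this to `{0 < re}`.  THIS FILE is that reduction, GENERIC (any index types; the face ABSTRACTED over a parameter type `P` carrying FILE 2b's Iwasawa data `(X₀, R, u₀, …)`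
through the readings `δ p = ‖det R‖ ≥ 0`, `T p = Σ_{ab} ‖(R h₁ R)_{ab}‖ ≥ 0`, `D p = ‖det(R h₁ R)‖ > 0` and an admissibility predicate `adm`; the determinant term is the
BLOW-UP term `1 + D^{−N′}` of FILE 2b, read with Lean's precedence `1 + ‖det‖ ^ (−N')`):
* §1 `re_pos_of_dist_lt_half` (a ball of radius `re z∕2` stays in `{0 < re}`); **`face_le_two_mul_face`** — merging constants: `cg' ≤ cg`, `N ≤ N₁`, `0 ≤ N' ≤ N₁'`
  (`T ≥ 0`, `D > 0`) give `face(cg,N,N') ≤ 2·face(cg',N₁,N₁')` (the determinant exponents merge UPWARDS with a factor `2`: ★ `one_add_rpow_neg_le_two_mul`, JUNCTION's device);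
* §2 **`eq_sum_on_rightHalfPlane_of_eq_sum`** — a linear relation `Ew = Σ_i a_i·EwG_i` valid on `{c < re}` (`0 ≤ c`) between functions holomorphic on `{0 < re}` holds on `{0 < re}`
  (★ `eqOn_of_eqOn_halfPlane`);
* §3 **`growth_uniform_of_finite_span`** — basis growth letters (FILE 2b's shape, constants local in `z`, per `i ∈ B`) + the half-plane linear relations + the coefficient bound
  `Σ_i ‖a u i‖ ≤ Ma` (`u ∈ K`) ⟹ ONE set of constants `(Cg, cg, N, N', r)` per `z` for the whole family: `Cg := 2·Ma·max_i Cg_i`, `cg := min_i`, `N := max_i`, `N' := max_i`,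
  `r := min(min_i r_i, re z∕2)`.
NOT HERE (honest; named in the census): (3d-i) FILE 2b′ — FILE 2b with `g` quantified AFTER its constants (the statement-level `(X₀,R)`-uniformity at `u₀ = 1`, LH4-p08's pen);
(3d-iii) the coefficient bound `Ma` from `hfin` + `hAc` + compactness of the stabiliser (unisolvent evaluation points), and the linearity letter `hlin` (linearity of the twisted
integral in the section) — both enter §3 BY VALUE.
[Shimura1997, §16.4, §18.4], [KudlaRallis1994, §1], [Conway1978, IV.3].
HONEST LABEL.  Count-neutral helper, closes no socket: `HC_CM` is proved only modulo the 7 printed citations (2 remaining named inputs: hLiu418 =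
`stmt-HodgeConjecture-24832`, h413 = `stmt-HodgeConjecture-24833`) until rung 0 closes.
-/

set_option autoImplicit false
set_option linter.dupNamespace false -- the mandated namespace repeats `HodgeConjecture.HodgeConjecture`

noncomputable section

open Set Metric

namespace Summit.HodgeConjecture.HodgeConjecture.Cruxes.HLiu418.K2LiuKindWArchGrowthKUniform

open Summit.HodgeConjecture.HodgeConjecture.Cruxes.HLiu418.K2LiuEisensteinContinuationGlue (eqOn_of_eqOn_halfPlane)
open Summit.HodgeConjecture.HodgeConjecture.Cruxes.HLiu418.K2LiuHermTwoXiSeriesLattice (one_add_rpow_neg_le_two_mul)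

/-! ## §1 The ball and the face -/

/-- a ball of radius `re z ∕ 2` about a point of the right half-plane stays in the right half-plane (`|re (s − z)| ≤ ‖s − z‖`). [folklore] -/
theorem re_pos_of_dist_lt_half {z s : ℂ} (hz : 0 < z.re) (hs : dist s z < z.re / 2) : 0 < s.re := by
  have h := Complex.abs_re_le_norm (s - z)
  rw [Complex.sub_re, ← dist_eq_norm] at h
  have h' := (abs_le.1 (h.trans hs.le)).1
  linarith

/-- **MERGING THE CONSTANTS OF THE FACE**: for `0 ≤ δ`, `0 ≤ T`, `0 < D` and `cg' ≤ cg`, `N ≤ N₁`, `0 ≤ N' ≤ N₁'`,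
`δ^{e}·e^{−cg·T}·(1+T)^N·(1 + D^{−N'}) ≤ 2·(δ^{e}·e^{−cg'·T}·(1+T)^{N₁}·(1 + D^{−N₁'}))` (★ `one_add_rpow_neg_le_two_mul` for the blow-up term). [folklore] -/
theorem face_le_two_mul_face {cg cg' N N₁ N' N₁' e δ T D : ℝ} (hδ : 0 ≤ δ) (hT : 0 ≤ T) (hD : 0 < D) (hcg : cg' ≤ cg) (hN : N ≤ N₁)
    (hN'0 : 0 ≤ N') (hN' : N' ≤ N₁') :
    δ ^ e * Real.exp (-(cg * T)) * (1 + T) ^ N * (1 + D ^ (-N')) ≤ 2 * (δ ^ e * Real.exp (-(cg' * T)) * (1 + T) ^ N₁ * (1 + D ^ (-N₁'))) := by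
  have h1 : Real.exp (-(cg * T)) ≤ Real.exp (-(cg' * T)) := Real.exp_le_exp.2 (by nlinarith)
  have h2 : (1 + T) ^ N ≤ (1 + T) ^ N₁ := Real.rpow_le_rpow_of_exponent_le (by linarith) hN
  have h3 : 1 + D ^ (-N') ≤ 2 * (1 + D ^ (-N₁')) := one_add_rpow_neg_le_two_mul hD hN'0 hN'
  have hδe : 0 ≤ δ ^ e := Real.rpow_nonneg hδ e
  have hD' : 0 ≤ 1 + D ^ (-N₁') := by positivity
  calc δ ^ e * Real.exp (-(cg * T)) * (1 + T) ^ N * (1 + D ^ (-N'))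
      ≤ δ ^ e * Real.exp (-(cg' * T)) * (1 + T) ^ N₁ * (2 * (1 + D ^ (-N₁'))) :=
        mul_le_mul (mul_le_mul (mul_le_mul_of_nonneg_left h1 hδe) h2 (Real.rpow_nonneg (by linarith) N) (mul_nonneg hδe (Real.exp_pos _).le))
          h3 (by positivity) (mul_nonneg (mul_nonneg hδe (Real.exp_pos _).le) (Real.rpow_nonneg (by linarith) N₁))
    _ = 2 * (δ ^ e * Real.exp (-(cg' * T)) * (1 + T) ^ N₁ * (1 + D ^ (-N₁'))) := by ring

/-! ## §2 A linear relation on a half-plane extends to the right half-plane -/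

/-- **`Ew = Σ_{i∈B} a_i·EwG_i` ON `{0 < re}` FROM THE SAME RELATION ON `{c < re}`** (`0 ≤ c`; all functions holomorphic on `{0 < re}`; ★ `eqOn_of_eqOn_halfPlane`).
[cite: Conway1978, IV.3] -/
theorem eq_sum_on_rightHalfPlane_of_eq_sum {ι : Type*} (B : Finset ι) {Ew : ℂ → ℂ} {EwG : ι → ℂ → ℂ} {a : ι → ℂ}
    (hEw : DifferentiableOn ℂ Ew {s : ℂ | 0 < s.re}) (hEwG : ∀ i ∈ B, DifferentiableOn ℂ (EwG i) {s : ℂ | 0 < s.re}) {c : ℝ} (hc : 0 ≤ c)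
    (hlin : ∀ s : ℂ, c < s.re → Ew s = ∑ i ∈ B, a i * EwG i s) :
    ∀ s : ℂ, 0 < s.re → Ew s = ∑ i ∈ B, a i * EwG i s := by
  intro s hs
  have h₁ : DifferentiableOn ℂ Ew ({s : ℂ | (0 : ℝ) < s.re} \ {(-1 : ℂ)}) := hEw.mono Set.sdiff_subset
  have h₂ : DifferentiableOn ℂ (fun s => ∑ i ∈ B, a i * EwG i s) ({s : ℂ | (0 : ℝ) < s.re} \ {(-1 : ℂ)}) :=
    (DifferentiableOn.fun_sum fun i hi => (differentiableOn_const (a i)).mul (hEwG i hi)).mono Set.sdiff_subset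
  have heq := eqOn_of_eqOn_halfPlane (E₁ := Ew) (E₂ := fun s => ∑ i ∈ B, a i * EwG i s) (s₀ := (-1 : ℂ)) hc h₁ h₂ hlin
  have hmem : s ∈ ({s : ℂ | (0 : ℝ) < s.re} \ {(-1 : ℂ)}) := by
    refine ⟨hs, fun h => ?_⟩
    rw [Set.mem_singleton_iff] at h
    rw [h] at hs
    norm_num at hs
  exact heq hmem

/-! ## §3 Uniform growth over a family spanned by finitely many continued letters -/

/-- **(3d-ii) UNIFORM GROWTH OF A FINITELY SPANNED FAMILY.**  Basis letters `EwG i` (`i ∈ B`) holomorphic on `{0 < re}`, each with FILE 2b-shaped growth near every `z`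
(constants `Cg cg N N' r` local in `z`; face `δ(p)^{2−2re s}·e^{−cg·T p}·(1+T p)^N·(1 + (D p)^{−N'})` on the admissible parameters `p`, `δ, T ≥ 0`, `D > 0` there); a family `Ew u` (`u ∈ K`)
holomorphic on `{0 < re}` with the LINEAR RELATION `Ew u = Σ_{i∈B} a u i·EwG i` on a half-plane `{c < re}` (`0 ≤ c`) and the COEFFICIENT BOUND `Σ_{i∈B} ‖a u i‖ ≤ Ma`.
THEN one set of constants per `z` serves the whole family: `∀ z, 0 < re z → ∃ Cg cg N N' r, … ∀ u ∈ K, ∀ s, dist s z < r → ∀ p, adm p → ‖Ew u s‖ ≤ Cg·face`.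
[cite: Shimura1997, §18.4] [cite: KudlaRallis1994, §1] [cite: Conway1978, IV.3] -/
theorem growth_uniform_of_finite_span {ι κ P : Type*} (B : Finset ι) (K : Set κ) (adm : P → Prop) (δ T D : P → ℝ)
    (hδ : ∀ p, adm p → 0 ≤ δ p) (hT : ∀ p, adm p → 0 ≤ T p) (hD : ∀ p, adm p → 0 < D p)
    -- the basis continuations and their growth letters (FILE 2b's shape)
    (EwG : ι → ℂ → ℂ) (hEwG : ∀ i ∈ B, DifferentiableOn ℂ (EwG i) {s : ℂ | 0 < s.re})
    (hgrowth : ∀ i ∈ B, ∀ z : ℂ, 0 < z.re → ∃ Cg cg N N' r : ℝ, 0 ≤ Cg ∧ 0 < cg ∧ 0 ≤ N ∧ 0 ≤ N' ∧ 0 < r ∧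
      ∀ s : ℂ, dist s z < r → ∀ p, adm p →
        ‖EwG i s‖ ≤ Cg * δ p ^ (2 - 2 * s.re) * Real.exp (-(cg * T p)) * (1 + T p) ^ N * (1 + D p ^ (-N')))
    -- the family: continuations, the linear relations on a half-plane, the coefficient bound
    (Ew : κ → ℂ → ℂ) (hEw : ∀ u ∈ K, DifferentiableOn ℂ (Ew u) {s : ℂ | 0 < s.re})
    (a : κ → ι → ℂ) {c : ℝ} (hc : 0 ≤ c) (hlin : ∀ u ∈ K, ∀ s : ℂ, c < s.re → Ew u s = ∑ i ∈ B, a u i * EwG i s)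
    {Ma : ℝ} (hMa0 : 0 ≤ Ma) (hMa : ∀ u ∈ K, ∑ i ∈ B, ‖a u i‖ ≤ Ma) :
    ∀ z : ℂ, 0 < z.re → ∃ Cg cg N N' r : ℝ, 0 ≤ Cg ∧ 0 < cg ∧ 0 ≤ N ∧ 0 ≤ N' ∧ 0 < r ∧
      ∀ u ∈ K, ∀ s : ℂ, dist s z < r → ∀ p, adm p →
        ‖Ew u s‖ ≤ Cg * δ p ^ (2 - 2 * s.re) * Real.exp (-(cg * T p)) * (1 + T p) ^ N * (1 + D p ^ (-N')) := by
  classical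
  intro z hz
  -- the linear relations on the whole right half-plane (§2)
  have hlin' : ∀ u ∈ K, ∀ s : ℂ, 0 < s.re → Ew u s = ∑ i ∈ B, a u i * EwG i s :=
    fun u hu => eq_sum_on_rightHalfPlane_of_eq_sum B (hEw u hu) hEwG hc (hlin u hu)
  -- per-basis constants at `z` (junk off `B`)
  have hch : ∀ i, ∃ Cg cg N N' r : ℝ, i ∈ B → (0 ≤ Cg ∧ 0 < cg ∧ 0 ≤ N ∧ 0 ≤ N' ∧ 0 < r ∧
      ∀ s : ℂ, dist s z < r → ∀ p, adm p →
        ‖EwG i s‖ ≤ Cg * δ p ^ (2 - 2 * s.re) * Real.exp (-(cg * T p)) * (1 + T p) ^ N * (1 + D p ^ (-N'))) := by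
    intro i
    by_cases hi : i ∈ B
    · obtain ⟨Cg, cg, N, N', r, h⟩ := hgrowth i hi z hz
      exact ⟨Cg, cg, N, N', r, fun _ => h⟩
    · exact ⟨0, 1, 0, 0, 1, fun h => (hi h).elim⟩
  choose Cgf cgf Nf N'f rf hspec using hch
  rcases B.eq_empty_or_nonempty with hB | hB
  · -- empty basis: every member of the family vanishes on `{0 < re}`
    refine ⟨0, 1, 0, 0, z.re / 2, le_rfl, one_pos, le_rfl, le_rfl, by positivity, fun u hu s hs p hp => ?_⟩
    have hs0 : 0 < s.re := re_pos_of_dist_lt_half hz hs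
    rw [hlin' u hu s hs0, hB, Finset.sum_empty, norm_zero]
    have hDp := hD p hp
    exact mul_nonneg (mul_nonneg (mul_nonneg (mul_nonneg le_rfl (Real.rpow_nonneg (hδ p hp) _)) (Real.exp_pos _).le)
      (Real.rpow_nonneg (by linarith [hT p hp]) _)) (by positivity)
  · -- merged constants over the nonempty finite basis
    obtain ⟨i₀, hi₀⟩ := hB
    have hCg0 : 0 ≤ B.sup' ⟨i₀, hi₀⟩ Cgf := (hspec i₀ hi₀).1.trans (Finset.le_sup' Cgf hi₀)
    have hcg0 : 0 < B.inf' ⟨i₀, hi₀⟩ cgf := (Finset.lt_inf'_iff _).2 fun i hi => (hspec i hi).2.1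
    have hN0 : 0 ≤ B.sup' ⟨i₀, hi₀⟩ Nf := (hspec i₀ hi₀).2.2.1.trans (Finset.le_sup' Nf hi₀)
    have hN'0 : 0 ≤ B.sup' ⟨i₀, hi₀⟩ N'f := (hspec i₀ hi₀).2.2.2.1.trans (Finset.le_sup' N'f hi₀)
    have hr0 : 0 < B.inf' ⟨i₀, hi₀⟩ rf := (Finset.lt_inf'_iff _).2 fun i hi => (hspec i hi).2.2.2.2.1
    refine ⟨2 * Ma * B.sup' ⟨i₀, hi₀⟩ Cgf, B.inf' ⟨i₀, hi₀⟩ cgf, B.sup' ⟨i₀, hi₀⟩ Nf, B.sup' ⟨i₀, hi₀⟩ N'f, min (B.inf' ⟨i₀, hi₀⟩ rf) (z.re / 2),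
      by positivity, hcg0, hN0, hN'0, lt_min hr0 (by positivity), fun u hu s hs p hp => ?_⟩
    have hs0 : 0 < s.re := re_pos_of_dist_lt_half hz (lt_of_lt_of_le hs (min_le_right _ _))
    have hsB : ∀ i ∈ B, dist s z < rf i := fun i hi => lt_of_lt_of_le (lt_of_lt_of_le hs (min_le_left _ _)) (Finset.inf'_le rf hi)
    -- the merged face and its nonnegativity
    have hDp := hD p hp
    set Φ : ℝ := δ p ^ (2 - 2 * s.re) * Real.exp (-(B.inf' ⟨i₀, hi₀⟩ cgf * T p)) * (1 + T p) ^ B.sup' ⟨i₀, hi₀⟩ Nf * (1 + D p ^ (-B.sup' ⟨i₀, hi₀⟩ N'f))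
      with hΦ
    have hΦ0 : 0 ≤ Φ := mul_nonneg (mul_nonneg (mul_nonneg (Real.rpow_nonneg (hδ p hp) _) (Real.exp_pos _).le)
      (Real.rpow_nonneg (by linarith [hT p hp]) _)) (by positivity)
    -- each basis letter is bounded by `2 · max Cg · Φ`
    have hbasis : ∀ i ∈ B, ‖EwG i s‖ ≤ 2 * B.sup' ⟨i₀, hi₀⟩ Cgf * Φ := by
      intro i hi
      have hb := (hspec i hi).2.2.2.2.2 s (hsB i hi) p hp
      have hface := face_le_two_mul_face (e := 2 - 2 * s.re) (hδ p hp) (hT p hp) hDp (Finset.inf'_le cgf hi) (Finset.le_sup' Nf hi)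
        (hspec i hi).2.2.2.1 (Finset.le_sup' N'f hi)
      calc ‖EwG i s‖ ≤ Cgf i * δ p ^ (2 - 2 * s.re) * Real.exp (-(cgf i * T p)) * (1 + T p) ^ Nf i * (1 + D p ^ (-N'f i)) := hb
        _ = Cgf i * (δ p ^ (2 - 2 * s.re) * Real.exp (-(cgf i * T p)) * (1 + T p) ^ Nf i * (1 + D p ^ (-N'f i))) := by ring
        _ ≤ B.sup' ⟨i₀, hi₀⟩ Cgf * (2 * Φ) := by
            rw [hΦ]
            exact mul_le_mul (Finset.le_sup' Cgf hi) hface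
              (mul_nonneg (mul_nonneg (mul_nonneg (Real.rpow_nonneg (hδ p hp) _) (Real.exp_pos _).le) (Real.rpow_nonneg (by linarith [hT p hp]) _))
                (by positivity)) hCg0
        _ = 2 * B.sup' ⟨i₀, hi₀⟩ Cgf * Φ := by ring
    -- sum up with the coefficient bound
    rw [hlin' u hu s hs0]
    calc ‖∑ i ∈ B, a u i * EwG i s‖ ≤ ∑ i ∈ B, ‖a u i * EwG i s‖ := norm_sum_le _ _
      _ ≤ ∑ i ∈ B, ‖a u i‖ * (2 * B.sup' ⟨i₀, hi₀⟩ Cgf * Φ) := Finset.sum_le_sum fun i hi => by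
          rw [norm_mul]
          exact mul_le_mul_of_nonneg_left (hbasis i hi) (norm_nonneg _)
      _ = (∑ i ∈ B, ‖a u i‖) * (2 * B.sup' ⟨i₀, hi₀⟩ Cgf * Φ) := by rw [Finset.sum_mul]
      _ ≤ Ma * (2 * B.sup' ⟨i₀, hi₀⟩ Cgf * Φ) := mul_le_mul_of_nonneg_right (hMa u hu) (by positivity)
      _ = 2 * Ma * B.sup' ⟨i₀, hi₀⟩ Cgf * δ p ^ (2 - 2 * s.re) * Real.exp (-(B.inf' ⟨i₀, hi₀⟩ cgf * T p)) *
            (1 + T p) ^ B.sup' ⟨i₀, hi₀⟩ Nf * (1 + D p ^ (-B.sup' ⟨i₀, hi₀⟩ N'f)) := by rw [hΦ]; ring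

/-! ## §4 (edition 2, additions only) The coefficient bound: a finitely spanned continuous family on a compact set has bounded coordinates -/

/-- **(3d-iii) THE COEFFICIENT BOUND.**  Let `V` be a finite-dimensional space of functions `X → ℂ` (the `K`-stable span of a `K`-finite section: `hfin`), `K` a COMPACT set of
parameters (the stabiliser), and `F u ∈ V` (`u ∈ K`) a family depending continuously on `u` pointwise on `X` (`hAc`-shape continuity).  THEN on the basis `G i` (`i : Fin d`,
`d = dim V`, Mathlib `Module.finBasis`) the coordinates `a u i` of `F u` satisfy `F u = Σ_i a u i · G i` and `Σ_i ‖a u i‖ ≤ Ma` uniformly on `K` — no unisolvence needed: a linear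
functional on a finite-dimensional Hausdorff topological vector space (here `V` with the topology of pointwise convergence) is automatically continuous (Mathlib
`LinearMap.continuous_of_finiteDimensional`), so each coordinate is continuous on the compact `K`, hence bounded. [folklore] [cite: Shimura1997, §18.4] -/
theorem exists_basis_coeff_bound {X κ : Type*} [TopologicalSpace κ] (V : Submodule ℂ (X → ℂ)) [FiniteDimensional ℂ V]
    {K : Set κ} (hK : IsCompact K) (F : κ → X → ℂ) (hF : ∀ u ∈ K, F u ∈ V) (hcont : ∀ x, ContinuousOn (fun u => F u x) K) :
    ∃ (d : ℕ) (G : Fin d → X → ℂ) (a : κ → Fin d → ℂ) (Ma : ℝ), 0 ≤ Ma ∧ (∀ i, G i ∈ V) ∧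
      (∀ u ∈ K, F u = fun x => ∑ i, a u i * G i x) ∧ (∀ u ∈ K, ∑ i, ‖a u i‖ ≤ Ma) := by
  classical
  set d := Module.finrank ℂ V with hd
  let b : Module.Basis (Fin d) ℂ V := Module.finBasis ℂ V
  -- coordinates (junk `0` off `K`)
  let a : κ → Fin d → ℂ := fun u i => if hu : u ∈ K then b.repr ⟨F u, hF u hu⟩ i else 0
  have ha : ∀ u (hu : u ∈ K) i, a u i = b.repr ⟨F u, hF u hu⟩ i := fun u hu i => by simp only [a, dif_pos hu]
  -- the span identity
  have hspan : ∀ u ∈ K, F u = fun x => ∑ i, a u i * (b i : X → ℂ) x := by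
    intro u hu
    have h := b.sum_repr ⟨F u, hF u hu⟩
    have h' := congrArg (fun v : V => (v : X → ℂ)) h
    simp only [Submodule.coe_sum, Submodule.coe_smul] at h'
    funext x
    have hx := congrFun h' x
    simp only [Finset.sum_apply, Pi.smul_apply, smul_eq_mul] at hx
    rw [← hx]
    exact Finset.sum_congr rfl fun i _ => by rw [ha u hu i]
  -- each coordinate is continuous on `K`: the family is continuous into `V` (pointwise topology) and coordinates are continuous linear functionals
  have hFc : Continuous fun u : K => (⟨F u, hF u u.2⟩ : V) := by
    refine Continuous.subtype_mk (continuous_pi fun x => ?_) _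
    exact (hcont x).comp_continuous continuous_subtype_val fun u => u.2
  have hcoord : ∀ i, ContinuousOn (fun u => a u i) K := by
    intro i
    rw [continuousOn_iff_continuous_restrict]
    have hc : Continuous fun u : K => b.coord i (⟨F u, hF u u.2⟩ : V) := (b.coord i).continuous_of_finiteDimensional.comp hFc
    refine hc.congr fun u => ?_
    show b.coord i ⟨F u, hF u u.2⟩ = a u i
    rw [ha u u.2 i]
    rfl
  -- bounded on the compact `K`
  have hbd : ∀ i, ∃ C, ∀ u ∈ K, ‖a u i‖ ≤ C := fun i => hK.exists_bound_of_continuousOn (hcoord i)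
  choose C hC using hbd
  refine ⟨d, fun i => (b i : X → ℂ), a, ∑ i, max (C i) 0, Finset.sum_nonneg fun i _ => le_max_right _ _, fun i => (b i).2, hspan, fun u hu => ?_⟩
  exact Finset.sum_le_sum fun i _ => (hC i u hu).trans (le_max_left _ _)

end Summit.HodgeConjecture.HodgeConjecture.Cruxes.HLiu418.K2LiuKindWArchGrowthKUniform

end
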